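import Literature.NumberTheory.GaloisRepresentations.IdeleSUnitsLayerChaseThree
import Literature.NumberTheory.GaloisRepresentations.IdeleSUnitsCohomologyDegreeTwo
import Literature.NumberTheory.GaloisRepresentations.IdeleSUnitsClassSequenceInflation
import Literature.NumberTheory.GaloisRepresentations.IdeleClassInvariantNaturality
import HarnessLib

/-!
# The finite-layer chase of NSW (8.3.11) for the `S`-units, III: the local-invariant arithmetic and the two transfer
# statements for the principal `S`-idèles `sUnitsIdeleRep`

Topic `NumberTheory/GaloisRepresentations`; namespace `Literature.NumberTheory.GaloisRepresentations.IdeleCohomology`.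
THEOREMS ONLY (no definition, no named fact, no instance, no `sorry`).  Sequel of `IdeleSUnitsLayerChaseTwo/Three`
(the cochain chases, binder-generic) which it INSTANTIATES on the lane's objects of record (`sUnitsIdeleRep F E S` = the
principal `S`-idèles `𝒪ˣ_{E,S} ↪ J_{E,S}`, `sUnitsIdeleInf` = their inflation, `ideleSInf`, `ideleSToClass`;
`IdeleSUnitsClassSequence(Inflation)`), supplying the arithmetic of local invariants (Tate: `H²(Gal(E/F), J_{E,S})` is read
by `(inv_v)_{v ∈ S}` with `n_v · inv_v = 0`, `n_v = [E_w : F_v]`, and every such family occurs — `IdeleSUnitsCohomologyDegreeTwo`)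
that turns GROWTH OF THE LOCAL DEGREES at `S` up the tower into the two inputs of the chases:

* §1 `exists_smul_eq_ideleSInf_of_localDegree_dvd` — if `p · n_{v,E} ∣ n_{v,E₁}` for `v ∈ S`, every `ξ ∈ H²(G, J_{E,S})` with
  trivial idèle-class image satisfies `p • ζ = Inf ξ` for some `ζ ∈ H²(G₁, J_{E₁,S})` with trivial idèle-class image
  (`b_v = a_v / p`, corrected at one place so that `Σ b_v = 0`);
* §2 `exists_map_ideleSToClass_eq_classInf_of_localDegree_dvd` — if `p^{a} · n_{v,E} ∣ n_{v,E₁}` (`p^a ∥ [E:F]`), every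
  `y ∈ H²(G, C_E)` whose multiple `p • y` is the class of an `S`-idèle class becomes at `E₁` the class of an `S`-idèle class
  (Bezout `u p^{a+1} + w m = 1`, `[E:F] = p^a m`: `inv(y) = u p^a · inv(p • y) + w m · inv(y)`, the first term spread over
  `S`, the second placed at one `v₀ ∈ S`);
* §3 THE DELIVERABLES (NSW (8.3.11) (iii)/(iv) at finite layers, for the colimit assembly): over a tower
  `F ⊆ E ⊆ E₁ ⊆ E₂` of finite Galois extensions of a totally complex `F`, `E/F` and `E₁/F` unramified outside `S`, with the
  local-degree hypothesis for `E ⊆ E₁` and the capitulation hypothesis `J_{E₁} ⊆ E₂ˣ · J_{E₂,S}` for `E₁ ⊆ E₂`: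
  `exists_smul_eq_sUnitsIdeleInf_sUnitsIdeleInf_two` (every `x ∈ H²(G, 𝒪ˣ_{E,S})` has `p • z = Inf Inf x`) and
  `sUnitsIdeleInf_sUnitsIdeleInf_three_eq_zero` (every `x ∈ H³(G, 𝒪ˣ_{E,S})` with `p • x = 0` has `Inf Inf x = 0`).

## References
* J. Neukirch, A. Schmidt, K. Wingberg, *Cohomology of Number Fields*, 2nd ed. (2008), VIII §3 (8.3.10)–(8.3.11),
  (8.3.17)–(8.3.18). [NeukirchSchmidtWingberg2008]
* J. W. S. Cassels, A. Fröhlich (eds.), *Algebraic Number Theory* (1967), Ch. VII (Tate) §7.3 Cor. 7.4, §11.2.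
  [CasselsFrohlichANT1967]
* D. Harari, *Galois Cohomology and Class Field Theory* (2020), §17.4, Cor. 17.14. [Harari2020]
-/

noncomputable section

open CategoryTheory NumberField IsDedekindDomain groupCohomology
open Literature.Algebra.Homology Literature.NumberTheory.Automorphic

namespace Literature.NumberTheory.GaloisRepresentations

namespace IdeleCohomology

/-! ## §0. Two bookkeeping lemmas on `ℚ/ℤ` and on the principal `S`-idèles -/

/-- In `ℚ/ℤ`: an element killed by `n` is `p` times an element killed by `p n` (`a = k/n ↦ b = k/(pn)`; `p ≠ 0`).
[folklore] -/
private theorem addCircle_exists_nsmul_eq_of_nsmul_eq_zero (a : AddCircle (1 : ℚ)) {n : ℕ} {p : ℕ} (hp : p ≠ 0)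
    (ha : n • a = 0) : ∃ b : AddCircle (1 : ℚ), p • b = a ∧ (p * n) • b = 0 := by
  obtain ⟨q, rfl⟩ := QuotientAddGroup.mk_surjective a
  have hq : ((n • q : ℚ) : AddCircle (1 : ℚ)) = 0 := by
    rw [← ha]; rfl
  obtain ⟨z, hz⟩ := (AddCircle.coe_eq_zero_iff (1 : ℚ)).1 hq
  refine ⟨((q / p : ℚ) : AddCircle (1 : ℚ)), ?_, ?_⟩
  · change ((p • (q / p) : ℚ) : AddCircle (1 : ℚ)) = _
    rw [nsmul_eq_mul, mul_div_cancel₀ q (Nat.cast_ne_zero.2 hp)]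
  · change (((p * n) • (q / p) : ℚ) : AddCircle (1 : ℚ)) = 0
    rw [AddCircle.coe_eq_zero_iff]
    refine ⟨z, ?_⟩
    rw [hz, nsmul_eq_mul, nsmul_eq_mul, Nat.cast_mul, mul_assoc, mul_left_comm, mul_div_cancel₀ q (Nat.cast_ne_zero.2 hp)]

variable {F : Type} [Field F] [NumberField F]

/-- An `S`-idèle comes from the principal `S`-idèles `sUnitsIdeleRep` iff it is principal (the binder hypothesis `hO` of
`exists_smul_eq_inf_inf_sUnits_two` / `inf_inf_sUnits_three_eq_zero` for the lane's object of record).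
[cite: NeukirchSchmidtWingberg2008, VIII §3 (8.3.9)] -/
theorem exists_sUnitsIdeleι_eq_iff {E : Type} [Field E] [NumberField E] [Algebra F E]
    (S : Finset (HeightOneSpectrum (𝓞 F))) (x : ideleSRep F E S) :
    (∃ o, (sUnitsIdeleι S).hom o = x) ↔ ((Additive.toMul x : ideleS F E S) : ideleGroup E) ∈ principalIdeles E := by
  rw [← mem_sUnitsIdeleSubmodule_iff_mem_principalIdeles]
  constructor
  · rintro ⟨o, rfl⟩
    exact (o : sUnitsIdeleSubmodule F E S).2
  · intro h
    exact ⟨(⟨x, h⟩ : sUnitsIdeleSubmodule F E S), rfl⟩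

/-! ## §1. `p`-division of `S`-idèle cohomology classes from growth of the local degrees -/

section Arith

variable {E E₁ : Type} [Field E] [NumberField E] [Field E₁] [NumberField E₁]
  [Algebra F E] [Algebra F E₁] [Algebra E E₁] [IsScalarTower F E E₁] [IsGalois F E] [IsGalois F E₁]
  (S : Finset (HeightOneSpectrum (𝓞 F)))

/-- The invariants of a class of `H²(Gal(E/F), J_{E,S})` are killed by the local degrees. [cite: CasselsFrohlichANT1967, Ch. VII §7.3 Cor. 7.4 (b)] -/
theorem localDegree_nsmul_localInv_map_ideleSRepHom (v : HeightOneSpectrum (𝓞 F))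
    (c : groupCohomology (ideleSRep F E S) 2) :
    localDegree E v • localInv E v (groupCohomology.map (MonoidHom.id (E ≃ₐ[F] E)) (ideleSRepHom S) 2 c) = 0 := by
  rw [localDegree_eq_natCard_stabilizer (chosenPlace (E := E) v), localInv_eq_localInvAt (chosenPlace (E := E) v)]
  exact natCard_stabilizer_nsmul_localInvAt _ _

/-- **`p`-division up one layer** (NSW (8.3.11) (iii), the local arithmetic): `F` totally complex, `E ⊆ E₁` finite Galois
over `F` and unramified outside `S`, and `p · [E_w : F_v] ∣ [E₁_{w₁} : F_v]` for `v ∈ S`.  Then every `ξ ∈ H²(Gal(E/F), J_{E,S})`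
whose idèle-class image vanishes satisfies `p • ζ = Inf ξ` for some `ζ ∈ H²(Gal(E₁/F), J_{E₁,S})` whose idèle-class image
vanishes.  Proof: the invariants `a_v` of `ξ` (`v ∈ S`) satisfy `n_{v,E} a_v = 0` and `Σ a_v = 0`; `b_v := a_v / p`, corrected
at one `v₀ ∈ S` by `c = Σ_v a_v/p` (`p c = 0`), is a family with `n_{v,E₁} b_v = 0`, `p b_v = a_v`, `Σ b_v = 0`; realise it.
[cite: NeukirchSchmidtWingberg2008, (8.3.11) (iii) with (8.3.10)] [cite: CasselsFrohlichANT1967, Ch. VII §7.3 Cor. 7.4 (b), §11.2] -/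
theorem exists_smul_eq_ideleSInf_of_localDegree_dvd [IsTotallyComplex F]
    (hS : ∀ v : HeightOneSpectrum (𝓞 F), v ∉ S → Algebra.IsUnramifiedIn (𝓞 E) v.asIdeal)
    (hS₁ : ∀ v : HeightOneSpectrum (𝓞 F), v ∉ S → Algebra.IsUnramifiedIn (𝓞 E₁) v.asIdeal)
    {p : ℕ} (hp : p ≠ 0) (hdeg : ∀ v ∈ S, p * localDegree E v ∣ localDegree E₁ v)
    (ξ : groupCohomology (ideleSRep F E S) 2)
    (hξ : groupCohomology.map (MonoidHom.id _) (ideleSToClass S) 2 ξ = 0) :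
    ∃ ζ : groupCohomology (ideleSRep F E₁ S) 2,
      (p : ℤ) • ζ = ideleSInf F E E₁ S 2 ξ ∧ groupCohomology.map (MonoidHom.id _) (ideleSToClass S) 2 ζ = 0 := by
  classical
  -- the invariants of `ξ`
  set a : HeightOneSpectrum (𝓞 F) → AddCircle (1 : ℚ) :=
    fun v => localInv E v (groupCohomology.map (MonoidHom.id _) (ideleSRepHom S) 2 ξ) with ha_def
  have han : ∀ v, localDegree E v • a v = 0 := fun v => localDegree_nsmul_localInv_map_ideleSRepHom S v ξ
  have hsum : ∑ v ∈ S, a v = 0 := by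
    rw [ha_def, ← classInvAll_map_ideleSToClass_eq_sum S ξ
      (fun v hv => localInv_map_ideleSRepHom_eq_zero_of_notMem S hS hv ξ), hξ, map_zero]
  -- `b_v = a_v / p`
  have hb' : ∀ v, ∃ b : AddCircle (1 : ℚ), p • b = a v ∧ (p * localDegree E v) • b = 0 :=
    fun v => addCircle_exists_nsmul_eq_of_nsmul_eq_zero (a v) hp (han v)
  choose b hb using hb'
  -- the inflated class and its invariants
  have hInf : ∀ v, localInv E₁ v (groupCohomology.map (MonoidHom.id _) (ideleSRepHom S) 2 (ideleSInf F E E₁ S 2 ξ)) = a v :=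
    fun v => by rw [map_ideleSRepHom_ideleSInf, localInv_ideleInf]
  rcases S.eq_empty_or_nonempty with hSe | ⟨v₀, hv₀⟩
  · -- `S = ∅`: everything supported on `S` vanishes
    refine ⟨0, ?_, by rw [map_zero]⟩
    rw [zsmul_zero]
    refine (eq_zero_of_forall_mem_localInv_eq_zero (E := E₁) S hS₁ _ fun v hv => ?_).symm
    rw [hSe] at hv
    exact absurd hv (Finset.notMem_empty v)
  · -- correct `b` at `v₀` by `c = Σ b_v`
    set c : AddCircle (1 : ℚ) := ∑ v ∈ S, b v with hc_def
    have hpc : p • c = 0 := by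
      rw [hc_def, Finset.smul_sum, ← hsum]
      exact Finset.sum_congr rfl fun v _ => (hb v).1
    set b' : HeightOneSpectrum (𝓞 F) → AddCircle (1 : ℚ) := Function.update b v₀ (b v₀ - c) with hb'_def
    have hb'n : ∀ v ∈ S, localDegree E₁ v • b' v = 0 := by
      intro v hv
      obtain ⟨k, hk⟩ := hdeg v hv
      rw [mul_comm] at hk
      by_cases hvv : v = v₀
      · subst hvv
        rw [hb'_def, Function.update_self, hk, mul_smul, smul_sub, (hb v).2, mul_comm p, mul_smul, hpc, smul_zero,
          sub_zero, smul_zero]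
      · rw [hb'_def, Function.update_of_ne hvv, hk, mul_smul, (hb v).2, smul_zero]
    have hb'p : ∀ v, p • b' v = a v := by
      intro v
      by_cases hvv : v = v₀
      · subst hvv
        rw [hb'_def, Function.update_self, smul_sub, hpc, sub_zero, (hb v).1]
      · rw [hb'_def, Function.update_of_ne hvv, (hb v).1]
    have hb's : ∑ v ∈ S, b' v = 0 := by
      have hc : c = b v₀ + ∑ x ∈ S \ {v₀}, b x := by
        rw [hc_def, Finset.sum_eq_add_sum_sdiff_singleton_of_mem hv₀]
      rw [hb'_def, Finset.sum_update_of_mem hv₀, hc]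
      abel
    obtain ⟨ζ, hζ⟩ := exists_forall_mem_localInv_eq (E := E₁) S b' hb'n
    refine ⟨ζ, ?_, ?_⟩
    · refine sub_eq_zero.1 (eq_zero_of_forall_mem_localInv_eq_zero (E := E₁) S hS₁ _ fun v hv => ?_)
      rw [map_sub, map_sub, map_zsmul, map_zsmul, hζ v hv, hInf, natCast_zsmul, hb'p, sub_self]
    · rw [← classInvAll_eq_zero_iff, classInvAll_map_ideleSToClass_eq_sum S ζ
        (fun v hv => localInv_map_ideleSRepHom_eq_zero_of_notMem S hS₁ hv ζ), ← hb's]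
      exact Finset.sum_congr rfl fun v hv => hζ v hv

/-! ## §2. Realisability of an idèle-class cohomology class by an `S`-idèle class one layer up -/

/-- **Realisability up one layer** (NSW (8.3.11) (iv), the local arithmetic): `F` totally complex, `E ⊆ E₁` finite Galois
over `F` and unramified outside `S ≠ ∅`, `p` a prime with `p^a · [E_w : F_v] ∣ [E₁_{w₁} : F_v]` for `v ∈ S`, where
`p^a ∥ [E:F]`.  If `y ∈ H²(Gal(E/F), C_E)` and `p • y` is the class of an `S`-idèle class `ξ`, then `Inf y ∈ H²(Gal(E₁/F), C_{E₁})`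
is the class of an `S`-idèle class.  Proof: `t = inv(y)` has `[E:F] t = 0` and `p t = Σ_{v∈S} a_v` (`a_v` the invariants of
`ξ`); with `[E:F] = p^a m` and Bezout `u p^{a+1} + w m = 1`, the family `b_v = u p^a a_v + δ_{v v₀} w m t` has `n_{v,E₁} b_v = 0`
and `Σ b_v = t`; realise it and compare total invariants (`inv_{E₁/F} ∘ Inf = inv_{E/F}`, injective).
[cite: NeukirchSchmidtWingberg2008, (8.3.11) (iv) with (8.3.10)] [cite: CasselsFrohlichANT1967, Ch. VII §7.3 Cor. 7.4 (b), §11.2] -/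
theorem exists_map_ideleSToClass_eq_classInf_of_localDegree_dvd [IsTotallyComplex F]
    (hS : ∀ v : HeightOneSpectrum (𝓞 F), v ∉ S → Algebra.IsUnramifiedIn (𝓞 E) v.asIdeal)
    (hS₁ : ∀ v : HeightOneSpectrum (𝓞 F), v ∉ S → Algebra.IsUnramifiedIn (𝓞 E₁) v.asIdeal)
    {p : ℕ} (hp : p.Prime) (hSne : S.Nonempty)
    (hdeg : ∀ v ∈ S, p ^ (Module.finrank F E).factorization p * localDegree E v ∣ localDegree E₁ v)
    (y : groupCohomology (IdeleClassGroup.galoisRep F E) 2)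
    (hy : ∃ ξ : groupCohomology (ideleSRep F E S) 2,
      groupCohomology.map (MonoidHom.id _) (ideleSToClass S) 2 ξ = (p : ℤ) • y) :
    ∃ ζ : groupCohomology (ideleSRep F E₁ S) 2,
      groupCohomology.map (MonoidHom.id _) (ideleSToClass S) 2 ζ = classInf F E E₁ 2 y := by
  classical
  obtain ⟨ξ, hξ⟩ := hy
  obtain ⟨v₀, hv₀⟩ := hSne
  -- notation
  set t : AddCircle (1 : ℚ) := classInvAll F E y with ht_def
  set a : HeightOneSpectrum (𝓞 F) → AddCircle (1 : ℚ) :=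
    fun v => localInv E v (groupCohomology.map (MonoidHom.id _) (ideleSRepHom S) 2 ξ) with ha_def
  set N : ℕ := Module.finrank F E with hN_def
  set e : ℕ := N.factorization p with he_def
  set m : ℕ := N / p ^ e with hm_def
  have hN0 : N ≠ 0 := Module.finrank_pos.ne'
  have hNpm : p ^ e * m = N := Nat.ordProj_mul_ordCompl_eq_self N p
  have hcop : Nat.Coprime (p ^ (e + 1)) m := (Nat.coprime_ordCompl hp hN0).pow_left (e + 1)
  obtain ⟨u, w, huw⟩ := Nat.isCoprime_iff_coprime.2 hcop
  -- the arithmetic of `t`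
  have han : ∀ v, localDegree E v • a v = 0 := fun v => localDegree_nsmul_localInv_map_ideleSRepHom S v ξ
  have hNt : N • t = 0 := by
    rw [ht_def, ← map_nsmul, hN_def, finrank_nsmul_eq_zero, map_zero]
  have hpt : (p : ℤ) • t = ∑ v ∈ S, a v := by
    rw [ht_def, ← map_zsmul, ← hξ, ha_def]
    exact classInvAll_map_ideleSToClass_eq_sum S ξ (fun v hv => localInv_map_ideleSRepHom_eq_zero_of_notMem S hS hv ξ)
  -- the family `b`
  set b : HeightOneSpectrum (𝓞 F) → AddCircle (1 : ℚ) :=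
    fun v => (u * (p : ℤ) ^ e) • a v + if v = v₀ then (w * (m : ℤ)) • t else 0 with hb_def
  have hbn : ∀ v ∈ S, localDegree E₁ v • b v = 0 := by
    intro v hv
    obtain ⟨k, hk⟩ := hdeg v hv
    have h1 : localDegree E₁ v • ((u * (p : ℤ) ^ e) • a v) = 0 := by
      rw [smul_comm, hk, mul_right_comm, mul_smul (p ^ e * k) (localDegree E v) (a v), han v, smul_zero, smul_zero]
    have h2 : localDegree E₁ v • ((w * (m : ℤ)) • t) = 0 := by
      have hkm : p ^ e * localDegree E v * k * m = (localDegree E v * k) * (p ^ e * m) := by ring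
      rw [mul_smul, smul_comm (localDegree E₁ v), natCast_zsmul, ← mul_smul (localDegree E₁ v), hk, hkm, mul_smul, hNpm,
        hNt, smul_zero, smul_zero]
    rw [hb_def]
    simp only []
    split_ifs
    · rw [smul_add, h1, h2, add_zero]
    · rw [add_zero, h1]
  have hbs : ∑ v ∈ S, b v = t := by
    rw [hb_def]
    simp only []
    rw [Finset.sum_add_distrib, ← Finset.smul_sum, ← hpt, Finset.sum_ite_eq' S v₀, if_pos hv₀, smul_smul,
      ← add_smul]
    have : u * (p : ℤ) ^ e * (p : ℤ) + w * (m : ℤ) = 1 := by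
      rw [← huw]; push_cast; ring
    rw [this, one_smul]
  -- realise `b` at the layer `E₁` and compare total invariants
  obtain ⟨ζ, hζ⟩ := exists_forall_mem_localInv_eq (E := E₁) S b hbn
  refine ⟨ζ, classInvAll_injective (F := F) (E := E₁) ?_⟩
  rw [classInvAll_map_ideleSToClass_eq_sum S ζ (fun v hv => localInv_map_ideleSRepHom_eq_zero_of_notMem S hS₁ hv ζ),
    classInvAll_classInf, ← ht_def, ← hbs]
  exact Finset.sum_congr rfl fun v hv => hζ v hv

end Arith

/-! ## §3. The deliverables: NSW (8.3.11) (iii) and (iv) at finite layers for the principal `S`-idèles -/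

section Final

variable {E E₁ E₂ : Type} [Field E] [NumberField E] [Field E₁] [NumberField E₁] [Field E₂] [NumberField E₂]
  [Algebra F E] [Algebra F E₁] [Algebra F E₂] [Algebra E E₁] [Algebra E₁ E₂]
  [IsScalarTower F E E₁] [IsScalarTower F E₁ E₂] [IsGalois F E] [IsGalois F E₁]
  (S : Finset (HeightOneSpectrum (𝓞 F)))

omit [IsGalois F E₁] in
/-- Pointwise square `J_{E,S} ↪ J_E` under the `S`-idèle layer change (`ideleSInflHom_comp_ideleSRepHom`).
[cite: NeukirchSchmidtWingberg2008, VIII §3 (8.3.9)] -/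
theorem ideleSRepHom_ideleSInflHom_apply (x : Rep.res (AlgEquiv.restrictNormalHom E) (ideleSRep F E S)) :
    (ideleSRepHom S).hom ((ideleSInflHom F E E₁ S).hom x) = (ideleInflHom F E E₁).hom ((ideleSRepHom S).hom x) :=
  congrArg (fun φ => φ.hom x) (ideleSInflHom_comp_ideleSRepHom (F := F) (E := E) (E' := E₁) S)

omit [IsGalois F E₁] in
/-- Pointwise square `𝒪ˣ_{E,S} ↪ J_{E,S}` under the layer change (`sUnitsIdeleInflHom_comp_ι`).
[cite: NeukirchSchmidtWingberg2008, VIII §3 (8.3.9)] -/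
theorem sUnitsIdeleι_sUnitsIdeleInflHom_apply (o : Rep.res (AlgEquiv.restrictNormalHom E) (sUnitsIdeleRep F E S)) :
    (sUnitsIdeleι S).hom ((sUnitsIdeleInflHom F E E₁ S).hom o) = (ideleSInflHom F E E₁ S).hom ((sUnitsIdeleι S).hom o) :=
  congrArg (fun φ => φ.hom o) (sUnitsIdeleInflHom_comp_ι (F := F) (E := E) (E' := E₁) S)

omit [IsGalois F E] in
/-- `H²` of `𝒪ˣ_{E,S} ↪ J_{E,S} → C_E` is zero (the composite morphism is zero).
[cite: NeukirchSchmidtWingberg2008, VIII §3 (8.3.9)] -/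
theorem map_ideleSToClass_map_sUnitsIdeleι (n : ℕ) (x : groupCohomology (sUnitsIdeleRep F E S) n) :
    groupCohomology.map (MonoidHom.id _) (ideleSToClass S) n
      (groupCohomology.map (MonoidHom.id _) (sUnitsIdeleι S) n x) = 0 := by
  change ((groupCohomology.functor ℤ (E ≃ₐ[F] E) n).map (sUnitsIdeleι S) ≫
    (groupCohomology.functor ℤ (E ≃ₐ[F] E) n).map (ideleSToClass S)) x = 0
  rw [← Functor.map_comp, sUnitsIdeleι_comp_ideleSToClass, Functor.map_zero]
  rfl

/-- **NSW (8.3.11) (iii) at finite layers, for the principal `S`-idèles.**  `F` totally complex; `F ⊆ E ⊆ E₁ ⊆ E₂` finite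
Galois; `E/F`, `E₁/F` unramified outside `S`; `p ≠ 0` with `p · [E_w : F_v] ∣ [E₁_{w₁} : F_v]` for `v ∈ S` (local degrees
grow — in `K_S ⊇ F(μ_{p^∞})` they do for `S ⊇ S_p`); every idèle of `E₁` lies in `E₂ˣ · J_{E₂,S}` (capitulation — principal
ideal theorem).  Then every `x ∈ H²(Gal(E/F), 𝒪ˣ_{E,S})` becomes divisible by `p` two layers up:
`p • z = Inf_{E₁→E₂} (Inf_{E→E₁} x)`.  (With the colimit over the layers of `K_S`: `H²(G_S, 𝒪ˣ_S)` is `p`-divisible.)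
[cite: NeukirchSchmidtWingberg2008, (8.3.11) (iii), (8.3.17)] [cite: Harari2020, §17.4, Cor. 17.14] -/
theorem exists_smul_eq_sUnitsIdeleInf_sUnitsIdeleInf_two [IsTotallyComplex F]
    (hS : ∀ v : HeightOneSpectrum (𝓞 F), v ∉ S → Algebra.IsUnramifiedIn (𝓞 E) v.asIdeal)
    (hS₁ : ∀ v : HeightOneSpectrum (𝓞 F), v ∉ S → Algebra.IsUnramifiedIn (𝓞 E₁) v.asIdeal)
    {p : ℕ} (hp : p ≠ 0) (hdeg : ∀ v ∈ S, p * localDegree E v ∣ localDegree E₁ v)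
    (hcap : ∀ a : ideleGroup E₁, AdeleRing.ideleBaseChange E₁ E₂ a ∈ principalIdeles E₂ ⊔ ideleS F E₂ S)
    (x : groupCohomology (sUnitsIdeleRep F E S) 2) :
    ∃ z : groupCohomology (sUnitsIdeleRep F E₂ S) 2,
      (p : ℤ) • z = sUnitsIdeleInf F E₁ E₂ S 2 (sUnitsIdeleInf F E E₁ S 2 x) := by
  have h0 : groupCohomology.map (MonoidHom.id _) (ideleSToClass S) 2
      (groupCohomology.map (MonoidHom.id _) (sUnitsIdeleι S) 2 x) = 0 := map_ideleSToClass_map_sUnitsIdeleι S 2 x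
  obtain ⟨ζ, hζ, hζ0⟩ := exists_smul_eq_ideleSInf_of_localDegree_dvd S hS hS₁ hp hdeg _ h0
  have hζ' : (p : ℤ) • ζ = groupCohomology.map (AlgEquiv.restrictNormalHom E) (ideleSInflHom F E E₁ S) 2
      (groupCohomology.map (MonoidHom.id _) (sUnitsIdeleι S) 2 x) := hζ
  have hζ0' : groupCohomology.map (MonoidHom.id _) (ideleSRepHom S ≫ IdeleClassGroup.classRepHom F E₁) 2 ζ = 0 := hζ0
  obtain ⟨z, hz⟩ := exists_smul_eq_inf_inf_sUnits_two (O := sUnitsIdeleRep F E S) (O₁ := sUnitsIdeleRep F E₁ S)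
    (O₂ := sUnitsIdeleRep F E₂ S) (sUnitsIdeleι S) (sUnitsIdeleι S) (sUnitsIdeleι S) (sUnitsIdeleι_injective S)
    (exists_sUnitsIdeleι_eq_iff S) (ideleSInflHom F E E₁ S) (ideleSInflHom F E₁ E₂ S) (sUnitsIdeleInflHom F E E₁ S)
    (sUnitsIdeleInflHom F E₁ E₂ S) (ideleSRepHom_ideleSInflHom_apply S) (ideleSRepHom_ideleSInflHom_apply S)
    (sUnitsIdeleι_sUnitsIdeleInflHom_apply S) (sUnitsIdeleι_sUnitsIdeleInflHom_apply S) hcap (exists_sUnitsIdeleι_eq_iff S)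
    x (p : ℤ) ζ hζ' hζ0'
  exact ⟨z, hz⟩

/-- **NSW (8.3.11) (iv) at finite layers, for the principal `S`-idèles.**  `F` totally complex; `F ⊆ E ⊆ E₁ ⊆ E₂` finite
Galois; `E/F`, `E₁/F` unramified outside `S ≠ ∅`; `p` prime with `p^a · [E_w : F_v] ∣ [E₁_{w₁} : F_v]` for `v ∈ S`,
`p^a ∥ [E:F]`; every idèle of `E₁` lies in `E₂ˣ · J_{E₂,S}`.  Then every `p`-torsion class `x ∈ H³(Gal(E/F), 𝒪ˣ_{E,S})` dies
two layers up: `Inf_{E₁→E₂} (Inf_{E→E₁} x) = 0`.  (With the colimit: `H³(G_S, 𝒪ˣ_S)[p] = 0`; by Kummer theory on the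
`p`-divisible `𝒪ˣ_S`, `H³(G_S, μ_p) = 0`, whence `cd_p G_S ≤ 2` at a totally complex base.)
[cite: NeukirchSchmidtWingberg2008, (8.3.11) (iv), (8.3.17), (8.3.18)] [cite: Harari2020, §17.4, Cor. 17.14] -/
theorem sUnitsIdeleInf_sUnitsIdeleInf_three_eq_zero [IsTotallyComplex F]
    (hS : ∀ v : HeightOneSpectrum (𝓞 F), v ∉ S → Algebra.IsUnramifiedIn (𝓞 E) v.asIdeal)
    (hS₁ : ∀ v : HeightOneSpectrum (𝓞 F), v ∉ S → Algebra.IsUnramifiedIn (𝓞 E₁) v.asIdeal)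
    {p : ℕ} (hp : p.Prime) (hSne : S.Nonempty)
    (hdeg : ∀ v ∈ S, p ^ (Module.finrank F E).factorization p * localDegree E v ∣ localDegree E₁ v)
    (hcap : ∀ a : ideleGroup E₁, AdeleRing.ideleBaseChange E₁ E₂ a ∈ principalIdeles E₂ ⊔ ideleS F E₂ S)
    (x : groupCohomology (sUnitsIdeleRep F E S) 3) (hx : (p : ℤ) • x = 0) :
    sUnitsIdeleInf F E₁ E₂ S 3 (sUnitsIdeleInf F E E₁ S 3 x) = 0 := by
  have hreal : ∀ y : groupCohomology (IdeleClassGroup.galoisRep F E) 2,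
      (∃ ξ : groupCohomology (ideleSRep F E S) 2,
          groupCohomology.map (MonoidHom.id _) (ideleSRepHom S ≫ IdeleClassGroup.classRepHom F E) 2 ξ = (p : ℤ) • y) →
      ∃ ζ : groupCohomology (ideleSRep F E₁ S) 2,
        groupCohomology.map (MonoidHom.id _) (ideleSRepHom S ≫ IdeleClassGroup.classRepHom F E₁) 2 ζ =
          classInf F E E₁ 2 y :=
    fun y hy => exists_map_ideleSToClass_eq_classInf_of_localDegree_dvd S hS hS₁ hp hSne hdeg y hy
  exact inf_inf_sUnits_three_eq_zero (O := sUnitsIdeleRep F E S) (O₁ := sUnitsIdeleRep F E₁ S)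
    (O₂ := sUnitsIdeleRep F E₂ S) (sUnitsIdeleι S) (sUnitsIdeleι S) (sUnitsIdeleι S) (sUnitsIdeleι_injective S)
    (exists_sUnitsIdeleι_eq_iff S) (ideleSInflHom F E E₁ S) (ideleSInflHom F E₁ E₂ S) (sUnitsIdeleInflHom F E E₁ S)
    (sUnitsIdeleInflHom F E₁ E₂ S) (ideleSRepHom_ideleSInflHom_apply S) (ideleSRepHom_ideleSInflHom_apply S)
    (sUnitsIdeleι_sUnitsIdeleInflHom_apply S) (sUnitsIdeleι_sUnitsIdeleInflHom_apply S) hcap (exists_sUnitsIdeleι_eq_iff S)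
    (isZero_H3_ideleSRep S hS) x (p : ℤ) hx hreal

end Final

end IdeleCohomology

end Literature.NumberTheory.GaloisRepresentations

end
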